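import Mathlib
import Summits.ResolutionOfSingularities.ResolutionOfSingularities.Theses.WeightedInvariant
import Literature.AlgebraicGeometry.Resolution.CobordantGame
import Literature.AlgebraicGeometry.Resolution.CobordantChartCoefficients
import Literature.AlgebraicGeometry.Resolution.AxisPolyhedron
import Summits.ResolutionOfSingularities.ResolutionOfSingularities.Theorems.WeightedInvariantLocalWeightedDropTameLift
import Summits.ResolutionOfSingularities.ResolutionOfSingularities.Theorems.WeightedInvariantLocalWeightedDropAxisPointMove
import Summits.ResolutionOfSingularities.ResolutionOfSingularities.Theorems.WeightedInvariantLocalWeightedDropAxisMove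
import Summits.ResolutionOfSingularities.ResolutionOfSingularities.Theorems.WeightedInvariantLocalWeightedDropAxisNormalize
import Summits.ResolutionOfSingularities.ResolutionOfSingularities.Theorems.WeightedInvariantLocalWeightedDropAxisWeightedMove
import Summits.ResolutionOfSingularities.ResolutionOfSingularities.Theorems.WeightedInvariantLocalWeightedDropAxisPreparation

/-!
# `LocalWeightedDrop`, line `hasse-ridge-face-selection`: the AXIS CUT is closed — germs with a one-dimensional apex are won

Route `ResolutionOfSingularities/WeightedInvariant`, crux `LocalWeightedDrop` (stmt-ResolutionOfSingularities-8899), line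
`hasse-ridge-face-selection`, skeleton v20 (chain w43, [OURS · L1 W4.3]): the sorry-free GLUE of the apex-dimension-one cut as
importable theorems, now that all five stubs B1–B5 are landed (`stub_axisNormalize` p133633, `stub_axisPreparation` p466340,
`stub_axisMove` p133482, `stub_axisWeightedMove` p464023, `stub_axisPointMove` p133466):
* `AxisCut.axisStartsWon` — in characteristic `p` over `k = k̄`, a singular germ of order `d ≥ 3` in `n + 3` variables whose
  tangent cone has a non-zero translation-invariance vector and all of whose invariance vectors are collinear (apex of
  dimension exactly one) is WON, given the singular germs of smaller order in the same number of variables (normalise the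
  axis, prepare along it by Hironaka's vertex dissolution, then blow up the equimultiple axis or play the weighted move
  `(m, …, m, 1)` fed with the point move);
* `AxisCut.coneStartsWon_local` — the tangent-cone split with the residual LOCAL core obligations only for apices of dimension
  `≥ 2` when `d ≥ 3`;
* `AxisCut.fixedDimStartsWon`, `AxisCut.higherStartsWon` — the (dimension, order) induction modulo the residual wide-apex cores
  W″ (`p ∣ d`) and T″ (`p ∤ d`, `N ≥ 4`), both taken as hypotheses with their registered signatures.
Deliberately NOT here: any claim about the residual cores (open mathematics; see `…LocalWeightedDropSurfacePieces`).
-/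

set_option linter.dupNamespace false -- mandated namespace of this single-conjunct summit

namespace Summit.ResolutionOfSingularities.ResolutionOfSingularities.Theorems

open Literature.AlgebraicGeometry.Resolution

namespace AxisCut

open Literature.AlgebraicGeometry.Resolution.CobordantGame

/-- GERMS WITH A ONE-DIMENSIONAL APEX ARE WON (every characteristic, `N = n + 3`), given the singular germs of smaller order:
normalise (B5), prepare (B1), then the axis move (B4) or the weighted move (B2 fed with B3). -/
theorem axisStartsWon (p : ℕ) (hp : p.Prime) (k : Type) [Field k] [CharP k p] [IsAlgClosed k] (n : ℕ)
    (f : MvPowerSeries (Fin (n + 3)) k) (hf : IsSingular k f)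
    (hord : ∀ g : MvPowerSeries (Fin (n + 3)) k, IsSingular k g → g.order < f.order → Won k (n + 3) g)
    (d : ℕ) (hd : f.order = d) (hd2 : 2 < d)
    (hone : ∃ c : Fin (n + 3) → k, c ≠ 0 ∧ ∀ v : Fin (n + 3) → k,
      CobordantChart.initEval (fun _ : Fin (n + 3) => 1) (v + c) d f =
        CobordantChart.initEval (fun _ : Fin (n + 3) => 1) v d f)
    (hcol : ∀ c₁ c₂ : Fin (n + 3) → k,
      (∀ v : Fin (n + 3) → k, CobordantChart.initEval (fun _ : Fin (n + 3) => 1) (v + c₁) d f =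
        CobordantChart.initEval (fun _ : Fin (n + 3) => 1) v d f) →
      (∀ v : Fin (n + 3) → k, CobordantChart.initEval (fun _ : Fin (n + 3) => 1) (v + c₂) d f =
        CobordantChart.initEval (fun _ : Fin (n + 3) => 1) v d f) →
      ∃ α β : k, (α ≠ 0 ∨ β ≠ 0) ∧ α • c₁ + β • c₂ = 0) :
    Won k (n + 3) f := by
  obtain ⟨θ, hθ0, hθdet, hgd, hcone, hapex⟩ := stub_axisNormalize k n f hf d hd hd2 hone hcol
  have hg : IsSingular k (MvPowerSeries.subst θ f) := TangentConeCut.isSingular_subst hθ0 hθdet hf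
  have hordg : ∀ h : MvPowerSeries (Fin (n + 3)) k, IsSingular k h → h.order < (MvPowerSeries.subst θ f).order →
      Won k (n + 3) h := fun h hh hlt => hord h hh (by rw [hd, ← hgd]; exact hlt)
  obtain ⟨ψ, -, hψ0, hψdet, hg'd, hcone', hapex', hcases⟩ :=
    stub_axisPreparation k (n + 2) d (MvPowerSeries.subst θ f) hgd hcone hapex
  have hg' : IsSingular k (MvPowerSeries.subst (AxisPolyhedron.shearFam ψ) (MvPowerSeries.subst θ f)) :=
    TangentConeCut.isSingular_subst hψ0 hψdet hg
  have hordg' : ∀ h : MvPowerSeries (Fin (n + 3)) k, IsSingular k h →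
      h.order < (MvPowerSeries.subst (AxisPolyhedron.shearFam ψ) (MvPowerSeries.subst θ f)).order → Won k (n + 3) h :=
    fun h hh hlt => hord h hh (by rw [hd, ← hg'd]; exact hlt)
  have hW : Won k (n + 3) (MvPowerSeries.subst (AxisPolyhedron.shearFam ψ) (MvPowerSeries.subst θ f)) := by
    rcases hcases with hin | ⟨hnot, hprep⟩
    · exact stub_axisMove p hp k (n + 2) d _ hg' hg'd hin hapex' hordg'
    · exact stub_axisWeightedMove p hp k (n + 2) d _ hg' hg'd hcone' hapex' hnot hprep hordg'
        (fun S hS hSd hSc hSa hSl hordS => stub_axisPointMove p hp k (n + 2) d S hS hSd hSc hSa hSl hordS)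
  rw [won_subst_iff hψ0 hψdet, won_subst_iff hθ0 hθdet] at hW
  exact hW

/-- THE TANGENT-CONE SPLIT with LOCAL core obligations, now only for apices of dimension `≥ 2` when `d ≥ 3` (the one-dimensional
apex is `axisStartsWon`); otherwise as `TameLift.coneStartsWon_local`. -/
theorem coneStartsWon_local (p : ℕ) (hp : p.Prime) (k : Type) [Field k] [CharP k p] [IsAlgClosed k]
    (n : ℕ) (f : MvPowerSeries (Fin (n + 3)) k) (hf : IsSingular k f)
    (hord : ∀ g : MvPowerSeries (Fin (n + 3)) k, IsSingular k g → g.order < f.order → Won k (n + 3) g)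
    (ℓ : Fin (n + 3) → k) (hℓ : ∀ i j : Fin (n + 3),
      MvPowerSeries.coeff (Finsupp.single i 1 + Finsupp.single j 1) f =
        MvPowerSeries.coeff (Finsupp.single i 1 + Finsupp.single j 1)
          ((∑ l, MvPowerSeries.C (ℓ l) * MvPowerSeries.X l) ^ 2))
    (d : ℕ) (hd : f.order = d)
    (hW : p ∣ d → (2 < d → ∃ c₁ c₂ : Fin (n + 3) → k, (∀ α β : k, α • c₁ + β • c₂ = 0 → α = 0 ∧ β = 0) ∧
      (∀ v : Fin (n + 3) → k, CobordantChart.initEval (fun _ : Fin (n + 3) => 1) (v + c₁) d f =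
        CobordantChart.initEval (fun _ : Fin (n + 3) => 1) v d f) ∧
      (∀ v : Fin (n + 3) → k, CobordantChart.initEval (fun _ : Fin (n + 3) => 1) (v + c₂) d f =
        CobordantChart.initEval (fun _ : Fin (n + 3) => 1) v d f)) → Won k (n + 3) f)
    (hT : 0 < n → ¬ p ∣ d → (2 < d → ∃ c₁ c₂ : Fin (n + 3) → k, (∀ α β : k, α • c₁ + β • c₂ = 0 → α = 0 ∧ β = 0) ∧
      (∀ v : Fin (n + 3) → k, CobordantChart.initEval (fun _ : Fin (n + 3) => 1) (v + c₁) d f =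
        CobordantChart.initEval (fun _ : Fin (n + 3) => 1) v d f) ∧
      (∀ v : Fin (n + 3) → k, CobordantChart.initEval (fun _ : Fin (n + 3) => 1) (v + c₂) d f =
        CobordantChart.initEval (fun _ : Fin (n + 3) => 1) v d f)) → Won k (n + 3) f) :
    Won k (n + 3) f := by
  have hd2 : 2 ≤ d := by
    have h := (FormalCoordChange.two_le_order_iff f).mpr hf.2
    rw [hd] at h
    exact_mod_cast h
  by_cases hℓ0 : ∃ i, ℓ i ≠ 0
  · -- DOUBLE POINT with square tangent quadric `ℓ² ≠ 0`: `d = 2`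
    obtain ⟨i, hi⟩ := hℓ0
    have hd' : d = 2 := TameLift.order_eq_two_of_sq hf hℓ hi hd
    by_cases hp2 : p = 2
    · subst hp2
      exact hW (by rw [hd']) (fun h => absurd h (by omega))
    · cases n with
      | zero =>
        exact TangentConeCut.tameDoublePointSurfaceWon (fun k _ _ => planeGermNonNCCount k) p hp hp2 k f hf
          ⟨ℓ, ⟨i, hi⟩, hℓ⟩
      | succ n =>
        exact hT (Nat.succ_pos n) (fun h => hp2 ((Nat.prime_dvd_prime_iff_eq hp Nat.prime_two).mp (hd' ▸ h)))
          (fun h => absurd h (by omega))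
  · -- tangent quadric ZERO: read the tangent cone of degree `d`
    by_cases hapex : ∃ c : Fin (n + 3) → k, c ≠ 0 ∧ ∀ v : Fin (n + 3) → k,
        CobordantChart.initEval (fun _ : Fin (n + 3) => 1) (v + c) d f =
          CobordantChart.initEval (fun _ : Fin (n + 3) => 1) v d f
    swap
    · push Not at hapex
      exact TangentConeCut.apexFreeStartsWon p hp k (Nat.succ_pos _) f d hd hord hapex
    -- apex of dimension exactly one (and `d ≥ 3`): the axis cut
    by_cases hwide : ∃ c₁ c₂ : Fin (n + 3) → k, (∀ α β : k, α • c₁ + β • c₂ = 0 → α = 0 ∧ β = 0) ∧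
        (∀ v : Fin (n + 3) → k, CobordantChart.initEval (fun _ : Fin (n + 3) => 1) (v + c₁) d f =
          CobordantChart.initEval (fun _ : Fin (n + 3) => 1) v d f) ∧
        (∀ v : Fin (n + 3) → k, CobordantChart.initEval (fun _ : Fin (n + 3) => 1) (v + c₂) d f =
          CobordantChart.initEval (fun _ : Fin (n + 3) => 1) v d f)
    swap
    · by_cases hd3 : 2 < d
      · refine axisStartsWon p hp k n f hf hord d hd hd3 hapex fun c₁ c₂ h₁ h₂ => ?_
        by_contra hdep
        push Not at hdep
        refine hwide ⟨c₁, c₂, fun α β hαβ => ?_, h₁, h₂⟩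
        by_contra hne
        rcases not_and_or.mp hne with hα | hβ
        · exact hdep α β (Or.inl hα) hαβ
        · exact hdep α β (Or.inr hβ) hαβ
      · -- `d = 2` with zero quadratic part cannot occur, but the cores absorb it vacuously
        by_cases hpd : p ∣ d
        · exact hW hpd (fun h => absurd h hd3)
        · cases n with
          | zero =>
            obtain ⟨e, rfl⟩ : ∃ e, d = e + 2 := ⟨d - 2, by omega⟩
            exact TameLift.tameSurfaceWon p hp k e f hf hd hpd hord
          | succ n => exact hT (Nat.succ_pos n) hpd (fun h => absurd h hd3)
    by_cases hpd : p ∣ d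
    · exact hW hpd (fun _ => hwide)
    · cases n with
      | zero =>
        obtain ⟨e, rfl⟩ : ∃ e, d = e + 2 := ⟨d - 2, by omega⟩
        exact TameLift.tameSurfaceWon p hp k e f hf hd hpd hord
      | succ n => exact hT (Nat.succ_pos n) hpd (fun _ => hwide)

/-- ALL SINGULAR GERMS IN DIMENSION `n + 3` ARE WON given the lower dimensions, modulo CORE W″ / CORE T″ (hypotheses). -/
theorem fixedDimStartsWon
    (hW : ∀ (p : ℕ), p.Prime → ∀ (k : Type) [Field k] [CharP k p] [IsAlgClosed k]
    (n : ℕ), (∀ m : ℕ, m < n + 3 → ∀ g : MvPowerSeries (Fin m) k,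
      CobordantGame.IsSingular k g → CobordantGame.Won k m g) →
    ∀ (f : MvPowerSeries (Fin (n + 3)) k), CobordantGame.IsSingular k f →
    (∀ g : MvPowerSeries (Fin (n + 3)) k, CobordantGame.IsSingular k g → g.order < f.order →
      CobordantGame.Won k (n + 3) g) →
    ∀ (d : ℕ), f.order = d → p ∣ d →
    (∃ ℓ : Fin (n + 3) → k, ∀ i j : Fin (n + 3),
      MvPowerSeries.coeff (Finsupp.single i 1 + Finsupp.single j 1) f =
        MvPowerSeries.coeff (Finsupp.single i 1 + Finsupp.single j 1)
          ((∑ l, MvPowerSeries.C (ℓ l) * MvPowerSeries.X l) ^ 2)) →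
    (2 < d → ∃ c₁ c₂ : Fin (n + 3) → k, (∀ α β : k, α • c₁ + β • c₂ = 0 → α = 0 ∧ β = 0) ∧
      (∀ v : Fin (n + 3) → k, CobordantChart.initEval (fun _ : Fin (n + 3) => 1) (v + c₁) d f =
        CobordantChart.initEval (fun _ : Fin (n + 3) => 1) v d f) ∧
      (∀ v : Fin (n + 3) → k, CobordantChart.initEval (fun _ : Fin (n + 3) => 1) (v + c₂) d f =
        CobordantChart.initEval (fun _ : Fin (n + 3) => 1) v d f)) →
    CobordantGame.Won k (n + 3) f)
    (hT : ∀ (p : ℕ), p.Prime → ∀ (k : Type) [Field k] [CharP k p] [IsAlgClosed k]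
    (n : ℕ), (∀ m : ℕ, m < n + 4 → ∀ g : MvPowerSeries (Fin m) k,
      CobordantGame.IsSingular k g → CobordantGame.Won k m g) →
    ∀ (f : MvPowerSeries (Fin (n + 4)) k), CobordantGame.IsSingular k f →
    (∀ g : MvPowerSeries (Fin (n + 4)) k, CobordantGame.IsSingular k g → g.order < f.order →
      CobordantGame.Won k (n + 4) g) →
    ∀ (d : ℕ), f.order = d → ¬ p ∣ d →
    (∃ ℓ : Fin (n + 4) → k, ∀ i j : Fin (n + 4),
      MvPowerSeries.coeff (Finsupp.single i 1 + Finsupp.single j 1) f =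
        MvPowerSeries.coeff (Finsupp.single i 1 + Finsupp.single j 1)
          ((∑ l, MvPowerSeries.C (ℓ l) * MvPowerSeries.X l) ^ 2)) →
    (2 < d → ∃ c₁ c₂ : Fin (n + 4) → k, (∀ α β : k, α • c₁ + β • c₂ = 0 → α = 0 ∧ β = 0) ∧
      (∀ v : Fin (n + 4) → k, CobordantChart.initEval (fun _ : Fin (n + 4) => 1) (v + c₁) d f =
        CobordantChart.initEval (fun _ : Fin (n + 4) => 1) v d f) ∧
      (∀ v : Fin (n + 4) → k, CobordantChart.initEval (fun _ : Fin (n + 4) => 1) (v + c₂) d f =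
        CobordantChart.initEval (fun _ : Fin (n + 4) => 1) v d f)) →
    CobordantGame.Won k (n + 4) f)
    (p : ℕ) (hp : p.Prime) (k : Type) [Field k] [CharP k p] [IsAlgClosed k]
    (n : ℕ) (IH : ∀ m : ℕ, m < n + 3 → ∀ g : MvPowerSeries (Fin m) k, IsSingular k g → Won k m g) :
    ∀ (f : MvPowerSeries (Fin (n + 3)) k), IsSingular k f → Won k (n + 3) f := by
  suffices key : ∀ (d : ℕ) (f : MvPowerSeries (Fin (n + 3)) k), f.order = d → IsSingular k f → Won k (n + 3) f by
    intro f hf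
    exact key _ f ((MvPowerSeries.ne_zero_iff_order_finite).mp hf.1).symm hf
  intro d
  induction d using Nat.strong_induction_on with
  | _ d IHd =>
    intro f hfd hf
    have hord : ∀ g : MvPowerSeries (Fin (n + 3)) k, IsSingular k g → g.order < f.order → Won k (n + 3) g := by
      intro g hg hlt
      have hgo : (g.order.toNat : ℕ∞) = g.order := (MvPowerSeries.ne_zero_iff_order_finite).mp hg.1
      refine IHd g.order.toNat ?_ g hgo.symm hg
      have : (g.order.toNat : ℕ∞) < (d : ℕ∞) := by rw [hgo, ← hfd]; exact hlt
      exact_mod_cast this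
    rcases stub_coneDichotomy k (n + 1) f hf with hhyp | ⟨ℓ, hℓ⟩
    · exact TangentConeCut.hyperbolicStartsWon (fun g hg => IH (n + 1) (by omega) g hg) f hf hhyp
    · refine coneStartsWon_local p hp k n f hf hord ℓ hℓ d hfd
        (fun hpd hcyl => hW p hp k n IH f hf hord d hfd hpd ⟨ℓ, hℓ⟩ hcyl) (fun hn hpd hcyl => ?_)
      cases n with
      | zero => exact absurd hn (lt_irrefl 0)
      | succ n => exact hT p hp k n IH f hf hord d hfd hpd ⟨ℓ, hℓ⟩ hcyl

/-- EVERY SINGULAR GERM IS WON modulo CORE W″ / CORE T″ (hypotheses): strong induction on `N`; `N ≤ 2` landed (`PlaneWon`). -/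
theorem higherStartsWon
    (hW : ∀ (p : ℕ), p.Prime → ∀ (k : Type) [Field k] [CharP k p] [IsAlgClosed k]
    (n : ℕ), (∀ m : ℕ, m < n + 3 → ∀ g : MvPowerSeries (Fin m) k,
      CobordantGame.IsSingular k g → CobordantGame.Won k m g) →
    ∀ (f : MvPowerSeries (Fin (n + 3)) k), CobordantGame.IsSingular k f →
    (∀ g : MvPowerSeries (Fin (n + 3)) k, CobordantGame.IsSingular k g → g.order < f.order →
      CobordantGame.Won k (n + 3) g) →
    ∀ (d : ℕ), f.order = d → p ∣ d →
    (∃ ℓ : Fin (n + 3) → k, ∀ i j : Fin (n + 3),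
      MvPowerSeries.coeff (Finsupp.single i 1 + Finsupp.single j 1) f =
        MvPowerSeries.coeff (Finsupp.single i 1 + Finsupp.single j 1)
          ((∑ l, MvPowerSeries.C (ℓ l) * MvPowerSeries.X l) ^ 2)) →
    (2 < d → ∃ c₁ c₂ : Fin (n + 3) → k, (∀ α β : k, α • c₁ + β • c₂ = 0 → α = 0 ∧ β = 0) ∧
      (∀ v : Fin (n + 3) → k, CobordantChart.initEval (fun _ : Fin (n + 3) => 1) (v + c₁) d f =
        CobordantChart.initEval (fun _ : Fin (n + 3) => 1) v d f) ∧
      (∀ v : Fin (n + 3) → k, CobordantChart.initEval (fun _ : Fin (n + 3) => 1) (v + c₂) d f =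
        CobordantChart.initEval (fun _ : Fin (n + 3) => 1) v d f)) →
    CobordantGame.Won k (n + 3) f)
    (hT : ∀ (p : ℕ), p.Prime → ∀ (k : Type) [Field k] [CharP k p] [IsAlgClosed k]
    (n : ℕ), (∀ m : ℕ, m < n + 4 → ∀ g : MvPowerSeries (Fin m) k,
      CobordantGame.IsSingular k g → CobordantGame.Won k m g) →
    ∀ (f : MvPowerSeries (Fin (n + 4)) k), CobordantGame.IsSingular k f →
    (∀ g : MvPowerSeries (Fin (n + 4)) k, CobordantGame.IsSingular k g → g.order < f.order →
      CobordantGame.Won k (n + 4) g) →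
    ∀ (d : ℕ), f.order = d → ¬ p ∣ d →
    (∃ ℓ : Fin (n + 4) → k, ∀ i j : Fin (n + 4),
      MvPowerSeries.coeff (Finsupp.single i 1 + Finsupp.single j 1) f =
        MvPowerSeries.coeff (Finsupp.single i 1 + Finsupp.single j 1)
          ((∑ l, MvPowerSeries.C (ℓ l) * MvPowerSeries.X l) ^ 2)) →
    (2 < d → ∃ c₁ c₂ : Fin (n + 4) → k, (∀ α β : k, α • c₁ + β • c₂ = 0 → α = 0 ∧ β = 0) ∧
      (∀ v : Fin (n + 4) → k, CobordantChart.initEval (fun _ : Fin (n + 4) => 1) (v + c₁) d f =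
        CobordantChart.initEval (fun _ : Fin (n + 4) => 1) v d f) ∧
      (∀ v : Fin (n + 4) → k, CobordantChart.initEval (fun _ : Fin (n + 4) => 1) (v + c₂) d f =
        CobordantChart.initEval (fun _ : Fin (n + 4) => 1) v d f)) →
    CobordantGame.Won k (n + 4) f)
    (p : ℕ) (hp : p.Prime) (k : Type) [Field k] [CharP k p] [IsAlgClosed k] :
    ∀ (N : ℕ) (f : MvPowerSeries (Fin N) k), IsSingular k f → Won k N f := by
  intro N
  induction N using Nat.strong_induction_on with
  | _ N IH =>
    intro f hf
    match N, f, hf, IH with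
    | 0, f, hf, _ => exact absurd hf (PlaneWon.not_isSingular_fin_zero f)
    | 1, f, hf, _ => exact PlaneWon.lineWon f hf
    | 2, f, hf, _ => exact stub_planeWon k f hf
    | n + 3, f, hf, IH => exact fixedDimStartsWon hW hT p hp k n (fun m hm g hg => IH m hm g hg) f hf


end AxisCut

end Summit.ResolutionOfSingularities.ResolutionOfSingularities.Theorems
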